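/-
Copyright (c) 2026. All rights reserved.
Released under Apache 2.0 license as described in the file LICENSE.
Authors: HodgeCM publication cell (pub-hodgecm), GR lane, seat GR-2 (`pub-hodgecm-own-hyp34`).
-/
import Literature.NumberTheory.GelbartRogawski1991.Prop311AsPrinted
import Literature.MeasureTheory.Integral.L2ProdTensorAmplification
import HarnessLib

/-!
# The printed topology of `Mp_𝐀(W)` ([GelbartRogawski1991, §3.1 p. 454]): translations are continuous, and a
# family of UNITARY pairs is continuous as soon as its matrix coefficients on a total set are

Topic `NumberTheory/GelbartRogawski1991`; namespace `Literature.NumberTheory.GelbartRogawski1991.Prop311`.  KERNEL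
ONLY: proved lemmas about the objects of the statement-exact typing `Prop311AsPrinted`; no definition, no named fact,
nothing of [GelbartRogawski1991] or [Weil1964] is asserted; `Prop311AsPrinted` is untouched.

[GelbartRogawski1991, Prop. 3.1.1 p. 455 L1–2] asks for a *continuous* section `s : G(𝐀) → Mp_𝐀(W)`; the typing renders
the (unprinted) topology of print's group of pairs `Mp_𝐀(W) = {(g, M_g)}` (p. 454 L21–27) as the initial topology of the
coordinates `p ↦ π(p) w ∈ W_𝐀` and `p ↦ M_p f ∈ S` (rendering R2, `Prop311.adelicMp.topologicalSpace`), "operator"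
meaning bounded operator (rendering R4).  This file supplies the two facts about that topology which the comparison
of print's Hilbert-space model with the tree's smooth metaplectic model ([Weil1964, Chap. I n° 11–13, Chap. III
n° 39]) consumes:

* §1 **`continuous_mul_left` / `continuous_mul_right` / `continuous_conj`**: for a fixed pair `P ∈ Mp_𝐀(W)` the maps
  `p ↦ P p`, `p ↦ p P`, `p ↦ P p P⁻¹` are continuous (`M_P` is bounded, R4; `π(P)` is `𝐀`-linear hence continuous
  for the adelic = module topology of `W_𝐀`, R8).  So a continuous homomorphism into `Mp_𝐀(W)` stays continuous
  after conjugation by a pair — the move from one adelic Darboux frame to another (sequel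
  `Prop311PrintedDarbouxLegsTransport`);
* §2 **`continuous_apply_of_dense_inner`** (general Hilbert-space lemma) and **`continuous_to_adelicMp_of_dense_inner`**:
  a family `x ↦ q x` of pairs whose operators `M_{q x}` are ISOMETRIC (print: "`ω_ψ` … a unitary representation",
  p. 454 L24–25) is continuous for the printed topology as soon as the coordinates `x ↦ π(q x) w` are continuous and
  the MATRIX COEFFICIENTS `x ↦ ⟪M_{q x} eᵢ, eⱼ⟫` are continuous for ONE family `(eᵢ)` with dense span (e.g. the
  Schwartz–Bruhat functions inside `L²`): weak continuity on a total set forces strong continuity for isometries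
  (`‖M eᵢ - M′ eᵢ‖² = 2‖eᵢ‖² - 2 Re ⟪M eᵢ, M′ eᵢ⟫`, then uniform approximation,
  `Literature.MeasureTheory.Integral.continuous_apply_of_dense`); **`continuous_to_adelicMp_of_dense`** is the variant
  with strong continuity given on the total family.

## References
* [GelbartRogawski1991] S. Gelbart, J. Rogawski, Invent. Math. 105 (1991) 445–472, §3.1 p. 454 L21–36, Prop. 3.1.1
  p. 455 L1–2.
* [ReedSimonI1980] M. Reed, B. Simon, *Methods of modern mathematical physics I*, §VIII.10 (strong vs. weak operator
  convergence for unitaries).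
* [Weil1964] A. Weil, Acta Math. 111 (1964) 143–211, Chap. III n° 37–39 (the topology of the metaplectic group).
-/

set_option autoImplicit false

noncomputable section

open NumberField Filter Topology
open scoped TensorProduct InnerProductSpace
open Literature.RepresentationTheory.HeisenbergGroup

namespace Literature.NumberTheory.GelbartRogawski1991

namespace Prop311

/-! ## §0. The coordinates of the printed topology (rendering R2) — private interface

(The public forms of these three lemmas belong to the model-independence file of the GR-1 lineage; private copies here
keep this leaf self-contained.) -/

section Coordinates

variable (F : Type) [Field F] [NumberField F]
variable (E : Type) [Field E] [Algebra F E]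
variable (V : Type) [AddCommGroup V] [Module F V]
variable (Φ : V →ₗ[F] V →ₗ[F] E)
variable {S : Type} [NormedAddCommGroup S] [InnerProductSpace ℂ S]
variable (ρ : Representation ℂ (AdelicHeisenberg F E V Φ) S)

/-- the coordinate `p ↦ π(p) w` is continuous. [cite: GelbartRogawski1991, §3.1 p. 454 L25–36] -/
private theorem continuous_projEnd_apply_aux (w : AdelicSpace F V) :
    @Continuous (adelicMp F E V Φ ρ) (AdelicSpace F V) _ (adelicSpaceTopology F V)
      fun p => projEnd F E V Φ ρ p w :=
  continuous_inf_dom_left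
    (t₂ := ⨅ f : S, TopologicalSpace.induced (fun p : adelicMp F E V Φ ρ => op F E V Φ ρ p f) inferInstance)
    (continuous_iInf_dom
      (t₁ := fun w : AdelicSpace F V =>
        TopologicalSpace.induced (fun p : adelicMp F E V Φ ρ => projEnd F E V Φ ρ p w) (adelicSpaceTopology F V))
      (i := w) continuous_induced_dom)

/-- the coordinate `p ↦ M_p f` is continuous. [cite: GelbartRogawski1991, §3.1 p. 454 L24–36] -/
private theorem continuous_op_apply_aux (f : S) : Continuous fun p : adelicMp F E V Φ ρ => op F E V Φ ρ p f :=
  continuous_inf_dom_right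
    (t₁ := ⨅ w : AdelicSpace F V,
      TopologicalSpace.induced (fun p : adelicMp F E V Φ ρ => projEnd F E V Φ ρ p w) (adelicSpaceTopology F V))
    (continuous_iInf_dom
      (t₁ := fun f : S => TopologicalSpace.induced (fun p : adelicMp F E V Φ ρ => op F E V Φ ρ p f) inferInstance)
      (i := f) continuous_induced_dom)

/-- a map into `Mp_𝐀(W)` is continuous when all its coordinates are. [cite: GelbartRogawski1991, §3.1 p. 454 L24–36] -/
private theorem continuous_to_adelicMp_aux {X : Type*} [TopologicalSpace X] {q : X → adelicMp F E V Φ ρ}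
    (h₁ : ∀ w : AdelicSpace F V, @Continuous X (AdelicSpace F V) _ (adelicSpaceTopology F V)
      fun x => projEnd F E V Φ ρ (q x) w)
    (h₂ : ∀ f : S, Continuous fun x => op F E V Φ ρ (q x) f) : Continuous q :=
  continuous_inf_rng.2 ⟨continuous_iInf_rng.2 fun w => continuous_induced_rng.2 (h₁ w),
    continuous_iInf_rng.2 fun f => continuous_induced_rng.2 (h₂ f)⟩

/-! ## §1. Translations and conjugation by a pair are continuous (R4: `M_P` bounded; R8: `π(P)` continuous) -/

/-- the operator `M_P` of a pair is continuous ("operator on the space of `ρ_ψ`" = bounded operator, rendering R4).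
[cite: GelbartRogawski1991, §3.1 p. 454 L23] -/
theorem continuous_op (P : adelicMp F E V Φ ρ) : Continuous (op F E V Φ ρ P) :=
  (Subgroup.mem_inf.1 P.2).2.1

/-- the inverse operator `M_P⁻¹` of a pair is continuous (rendering R4). [cite: GelbartRogawski1991, §3.1 p. 454 L23] -/
theorem continuous_op_symm (P : adelicMp F E V Φ ρ) : Continuous (op F E V Φ ρ P).symm :=
  (Subgroup.mem_inf.1 P.2).2.2

/-- `π(P)` is continuous on `W_𝐀` for the adelic topology (an `𝐀`-linear map; rendering R8).
[cite: GelbartRogawski1991, §3.1 p. 454 L22–25] -/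
theorem continuous_proj_coe (P : adelicMp F E V Φ ρ) :
    @Continuous (AdelicSpace F V) (AdelicSpace F V) (adelicSpaceTopology F V) (adelicSpaceTopology F V)
      ((proj F E V Φ ρ P : adelicSp F E V Φ) : AdelicSpace F V ≃ₗ[AdeleRing (𝓞 F) F] AdelicSpace F V) := by
  letI : TopologicalSpace (AdelicSpace F V) := adelicSpaceTopology F V
  haveI : IsModuleTopology (AdeleRing (𝓞 F) F) (AdelicSpace F V) := ⟨rfl⟩
  haveI : ContinuousAdd (AdelicSpace F V) := IsModuleTopology.toContinuousAdd (AdeleRing (𝓞 F) F) (AdelicSpace F V)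
  exact IsModuleTopology.continuous_of_linearMap
    ((proj F E V Φ ρ P : adelicSp F E V Φ) : AdelicSpace F V ≃ₗ[AdeleRing (𝓞 F) F] AdelicSpace F V).toLinearMap

/-- **left translation `p ↦ P p` is continuous on `Mp_𝐀(W)`** (printed topology R2).
[cite: GelbartRogawski1991, §3.1 p. 454 L21–27] -/
theorem continuous_mul_left (P : adelicMp F E V Φ ρ) : Continuous fun p : adelicMp F E V Φ ρ => P * p := by
  refine continuous_to_adelicMp_aux F E V Φ ρ (fun w => ?_) (fun f => ?_)
  · have h : (fun p : adelicMp F E V Φ ρ => projEnd F E V Φ ρ (P * p) w) = fun p =>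
        ((proj F E V Φ ρ P : adelicSp F E V Φ) : AdelicSpace F V ≃ₗ[AdeleRing (𝓞 F) F] AdelicSpace F V)
          (projEnd F E V Φ ρ p w) := by
      funext p
      rfl
    rw [h]
    exact @Continuous.comp _ _ _ _ (adelicSpaceTopology F V) (adelicSpaceTopology F V) _ _
      (continuous_proj_coe F E V Φ ρ P) (continuous_projEnd_apply_aux F E V Φ ρ w)
  · show Continuous fun p : adelicMp F E V Φ ρ => op F E V Φ ρ P (op F E V Φ ρ p f)
    exact (continuous_op F E V Φ ρ P).comp (continuous_op_apply_aux F E V Φ ρ f)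

/-- **right translation `p ↦ p P` is continuous on `Mp_𝐀(W)`** (printed topology R2).
[cite: GelbartRogawski1991, §3.1 p. 454 L21–27] -/
theorem continuous_mul_right (P : adelicMp F E V Φ ρ) : Continuous fun p : adelicMp F E V Φ ρ => p * P := by
  refine continuous_to_adelicMp_aux F E V Φ ρ (fun w => ?_) (fun f => ?_)
  · show @Continuous (adelicMp F E V Φ ρ) (AdelicSpace F V) _ (adelicSpaceTopology F V) fun p =>
        projEnd F E V Φ ρ p
          (((proj F E V Φ ρ P : adelicSp F E V Φ) : AdelicSpace F V ≃ₗ[AdeleRing (𝓞 F) F] AdelicSpace F V) w)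
    exact continuous_projEnd_apply_aux F E V Φ ρ _
  · show Continuous fun p : adelicMp F E V Φ ρ => op F E V Φ ρ p (op F E V Φ ρ P f)
    exact continuous_op_apply_aux F E V Φ ρ _

/-- **conjugation `p ↦ P p P⁻¹` by a pair is continuous on `Mp_𝐀(W)`** (printed topology R2): a continuous map into
`Mp_𝐀(W)` remains continuous after conjugation — the change of adelic Darboux frame.
[cite: GelbartRogawski1991, §3.1 p. 454 L21–27] -/
theorem continuous_conj (P : adelicMp F E V Φ ρ) : Continuous fun p : adelicMp F E V Φ ρ => P * p * P⁻¹ :=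
  (continuous_mul_right F E V Φ ρ P⁻¹).comp (continuous_mul_left F E V Φ ρ P)

end Coordinates

/-! ## §2. Weak continuity on a total set forces strong continuity for isometries -/

section Dense

/-- **strong continuity of a family of isometries from the continuity of its matrix coefficients on a total family.**
`A : T → (E →ₗ E)` linear isometries of a complex inner-product space, `(eᵢ)` a family with dense span: if every
coefficient `t ↦ ⟪A t eᵢ, eⱼ⟫` is continuous then every orbit map `t ↦ A t v` is continuous.  (Weak continuity
against the `eⱼ` extends to all vectors by uniform approximation; then `‖A t eᵢ - A t₀ eᵢ‖² = 2‖eᵢ‖² - 2 Re ⟪A t eᵢ,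
A t₀ eᵢ⟫ → 0`; then `continuous_apply_of_dense`.) [cite: ReedSimonI1980, §VIII.10] -/
theorem continuous_apply_of_dense_inner {T : Type*} [TopologicalSpace T] {E : Type*} [NormedAddCommGroup E]
    [InnerProductSpace ℂ E] {ι : Type*} (e : ι → E) (he : Dense (Submodule.span ℂ (Set.range e) : Set E))
    (A : T → E →ₗ[ℂ] E) (hA : ∀ (t : T) (v : E), ‖A t v‖ = ‖v‖)
    (hc : ∀ i j, Continuous fun t => ⟪A t (e i), e j⟫_ℂ) (v : E) :
    Continuous fun t => A t v := by
  -- Step 1: weak continuity of `t ↦ A t (e i)` against EVERY vector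
  have step1 : ∀ (i : ι) (w : E), Continuous fun t => ⟪A t (e i), w⟫_ℂ := by
    intro i
    let K : Submodule ℂ E :=
      { carrier := {w | Continuous fun t => ⟪A t (e i), w⟫_ℂ}
        add_mem' := fun {u w} hu hw => by
          change Continuous fun t => ⟪A t (e i), u + w⟫_ℂ
          simp only [inner_add_right]
          exact Continuous.add hu hw
        zero_mem' := by
          change Continuous fun t => ⟪A t (e i), (0 : E)⟫_ℂ
          simp only [inner_zero_right]
          exact continuous_const
        smul_mem' := fun c {u} hu => by
          change Continuous fun t => ⟪A t (e i), c • u⟫_ℂ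
          simp only [inner_smul_right]
          exact continuous_const.mul hu }
    have hKc : IsClosed (K : Set E) := by
      refine isClosed_of_closure_subset fun w hw => ?_
      change Continuous fun t => ⟪A t (e i), w⟫_ℂ
      refine continuous_iff_continuousAt.2 fun t₀ => ?_
      rw [ContinuousAt, Metric.tendsto_nhds]
      intro ε hε
      have hpos : 0 < ‖e i‖ + 1 := by positivity
      obtain ⟨u, hu, huw⟩ := Metric.mem_closure_iff.1 hw (ε / (3 * (‖e i‖ + 1))) (by positivity)
      have huc : Continuous fun t => ⟪A t (e i), u⟫_ℂ := hu
      have hev : ∀ᶠ t in 𝓝 t₀, dist ⟪A t (e i), u⟫_ℂ ⟪A t₀ (e i), u⟫_ℂ < ε / 3 :=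
        Metric.tendsto_nhds.1 (huc.tendsto t₀) _ (by positivity)
      have hb : ∀ s : T, dist ⟪A s (e i), w⟫_ℂ ⟪A s (e i), u⟫_ℂ < ε / 3 := fun s => by
        rw [dist_eq_norm, ← inner_sub_right]
        calc ‖⟪A s (e i), w - u⟫_ℂ‖ ≤ ‖A s (e i)‖ * ‖w - u‖ := norm_inner_le_norm _ _
          _ = ‖e i‖ * dist w u := by rw [hA, dist_eq_norm]
          _ ≤ (‖e i‖ + 1) * dist w u := by gcongr; linarith
          _ < (‖e i‖ + 1) * (ε / (3 * (‖e i‖ + 1))) := by gcongr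
          _ = ε / 3 := by field_simp
      filter_upwards [hev] with t ht
      calc dist ⟪A t (e i), w⟫_ℂ ⟪A t₀ (e i), w⟫_ℂ
          ≤ dist ⟪A t (e i), w⟫_ℂ ⟪A t (e i), u⟫_ℂ + dist ⟪A t (e i), u⟫_ℂ ⟪A t₀ (e i), u⟫_ℂ +
              dist ⟪A t₀ (e i), u⟫_ℂ ⟪A t₀ (e i), w⟫_ℂ := dist_triangle4 _ _ _ _
        _ < ε / 3 + ε / 3 + ε / 3 := by
            gcongr
            · exact hb t
            · rw [dist_comm]; exact hb t₀
        _ = ε := by ring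
    have hle : Submodule.span ℂ (Set.range e) ≤ K := Submodule.span_le.2 (Set.range_subset_iff.2 fun j => hc i j)
    have hK : K = ⊤ := by
      have hcl : (Submodule.span ℂ (Set.range e)).topologicalClosure ≤ K := by
        rw [← hKc.submodule_topologicalClosure_eq]
        exact Submodule.topologicalClosure_mono hle
      rw [Submodule.dense_iff_topologicalClosure_eq_top] at he
      rw [he] at hcl
      exact top_le_iff.1 hcl
    intro w
    have hw : w ∈ K := by rw [hK]; exact Submodule.mem_top
    exact hw
  -- Step 2: strong continuity on the family, from `‖a - b‖² = ‖a‖² - 2 Re⟪a, b⟫ + ‖b‖²` and `‖A t eᵢ‖ = ‖eᵢ‖`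
  have step2 : ∀ i, Continuous fun t => A t (e i) := by
    intro i
    refine continuous_iff_continuousAt.2 fun t₀ => ?_
    let r : T → ℝ := fun t => Real.sqrt (2 * ‖e i‖ ^ 2 - 2 * RCLike.re ⟪A t (e i), A t₀ (e i)⟫_ℂ)
    have hr : Continuous r :=
      Real.continuous_sqrt.comp (continuous_const.sub
        (continuous_const.mul (RCLike.continuous_re.comp (step1 i (A t₀ (e i))))))
    have hr0 : r t₀ = 0 := by
      show Real.sqrt (2 * ‖e i‖ ^ 2 - 2 * RCLike.re ⟪A t₀ (e i), A t₀ (e i)⟫_ℂ) = 0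
      rw [inner_self_eq_norm_sq, hA, sub_self, Real.sqrt_zero]
    have key : ∀ t, ‖A t (e i) - A t₀ (e i)‖ = r t := fun t => by
      show ‖A t (e i) - A t₀ (e i)‖ = Real.sqrt (2 * ‖e i‖ ^ 2 - 2 * RCLike.re ⟪A t (e i), A t₀ (e i)⟫_ℂ)
      rw [← Real.sqrt_sq (norm_nonneg (A t (e i) - A t₀ (e i))), @norm_sub_sq ℂ, hA, hA]
      ring_nf
    rw [ContinuousAt, tendsto_iff_norm_sub_tendsto_zero]
    have ht : Tendsto r (𝓝 t₀) (𝓝 0) := by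
      rw [← hr0]
      exact hr.tendsto t₀
    exact ht.congr fun t => (key t).symm
  -- Step 3: all vectors, by uniform approximation
  exact Literature.MeasureTheory.Integral.continuous_apply_of_dense e he A hA step2 v

variable (F : Type) [Field F] [NumberField F]
variable (E : Type) [Field E] [Algebra F E]
variable (V : Type) [AddCommGroup V] [Module F V]
variable (Φ : V →ₗ[F] V →ₗ[F] E)
variable {S : Type} [NormedAddCommGroup S] [InnerProductSpace ℂ S]
variable (ρ : Representation ℂ (AdelicHeisenberg F E V Φ) S)

/-- **continuity INTO `Mp_𝐀(W)` from strong continuity on a total family**: a family of pairs `x ↦ q x` with ISOMETRIC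
operators `M_{q x}` is continuous for the printed topology as soon as the coordinates `x ↦ π(q x) w` are continuous
and `x ↦ M_{q x} eᵢ` is continuous for a family `(eᵢ)` with dense span in `S`.
[cite: GelbartRogawski1991, §3.1 p. 454 L24–36; ReedSimonI1980, §VIII.10] -/
theorem continuous_to_adelicMp_of_dense {X : Type*} [TopologicalSpace X] {q : X → adelicMp F E V Φ ρ}
    (h₁ : ∀ w : AdelicSpace F V, @Continuous X (AdelicSpace F V) _ (adelicSpaceTopology F V)
      fun x => projEnd F E V Φ ρ (q x) w)
    (hu : ∀ (x : X) (f : S), ‖op F E V Φ ρ (q x) f‖ = ‖f‖)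
    {ι : Type*} (e : ι → S) (he : Dense (Submodule.span ℂ (Set.range e) : Set S))
    (h₂ : ∀ i, Continuous fun x => op F E V Φ ρ (q x) (e i)) : Continuous q := by
  refine continuous_to_adelicMp_aux F E V Φ ρ h₁ fun f => ?_
  have h := Literature.MeasureTheory.Integral.continuous_apply_of_dense e he
    (fun x => (op F E V Φ ρ (q x) : S →ₗ[ℂ] S)) (fun x v => hu x v) (fun i => h₂ i) f
  exact h

/-- **continuity INTO `Mp_𝐀(W)` from the continuity of matrix coefficients on a total family** (the junction consumed
by the comparison with the smooth model): a family of pairs `x ↦ q x` with ISOMETRIC operators `M_{q x}` is continuous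
for the printed topology as soon as the coordinates `x ↦ π(q x) w` are continuous and the matrix coefficients
`x ↦ ⟪M_{q x} eᵢ, eⱼ⟫` are continuous for ONE family `(eᵢ)` with dense span in `S` (e.g. the Schwartz–Bruhat vectors).
[cite: GelbartRogawski1991, §3.1 p. 454 L24–36; ReedSimonI1980, §VIII.10] -/
theorem continuous_to_adelicMp_of_dense_inner {X : Type*} [TopologicalSpace X] {q : X → adelicMp F E V Φ ρ}
    (h₁ : ∀ w : AdelicSpace F V, @Continuous X (AdelicSpace F V) _ (adelicSpaceTopology F V)
      fun x => projEnd F E V Φ ρ (q x) w)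
    (hu : ∀ (x : X) (f : S), ‖op F E V Φ ρ (q x) f‖ = ‖f‖)
    {ι : Type*} (e : ι → S) (he : Dense (Submodule.span ℂ (Set.range e) : Set S))
    (h₂ : ∀ i j, Continuous fun x => ⟪op F E V Φ ρ (q x) (e i), e j⟫_ℂ) : Continuous q := by
  refine continuous_to_adelicMp_aux F E V Φ ρ h₁ fun f => ?_
  have h := continuous_apply_of_dense_inner e he (fun x => (op F E V Φ ρ (q x) : S →ₗ[ℂ] S))
    (fun x v => hu x v) (fun i j => h₂ i j) f
  exact h

end Dense

end Prop311

end Literature.NumberTheory.GelbartRogawski1991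

end
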